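import Mathlib.MeasureTheory.Constructions.Pi
import Mathlib.MeasureTheory.Integral.Bochner.Basic
import Mathlib.MeasureTheory.Measure.Lebesgue.Basic
import Mathlib.Analysis.SpecialFunctions.Trigonometric.Basic
import Mathlib.Data.Sym.Sym2
import Literature.MathematicalPhysics.QuantumFieldTheory.U1VillainMasslessPhotonD4
import HarnessLib

/-!
# Ginibre monotonicity for the Villain model (Aizenman–Harel–Peled–Shapiro 2021, Cor. 11.4)

Topic `Literature/Probability/LatticeModels` (next to `GinibreInequality.lean`, which PROVES
Ginibre's monotone inequality for `XY`-type weights `exp(∑ Jₐ Re χₐ)` on compact abelian groups).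
This file holds ONE NAMED FACT and the three small definitions it needs; no proofs.

## The model (as printed)

Aizenman–Harel–Peled–Shapiro, *Depinning in integer-restricted Gaussian fields and BKT phases of
two-component spin models*, arXiv:2110.09498, §3.1: the `XY` partition function on a finite
graph is `Z = ∫_{[-π,π)^𝒱} ∏_{{u,v} ∈ ℰ} e^{βJ_{u,v} cos(θ_u − θ_v)} ∏_x dθ_x`, and "In the Villain
version of the `O(2)` model each of the interaction factors … is replaced through the following
substitution `e^{βJ_{u,v} cos(θ_u − θ_v)} ⟹ ∑_{m_{uv} ∈ ℤ} e^{−βJ_{u,v}(θ_u − θ_v + 2πm_{uv})²/2}`";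
the Gibbs state is the normalised measure and the spin–spin two-point function is
`⟨σ_x · σ_y⟩ = ⟨cos(θ_x − θ_y)⟩`. In the appendix §11 "we allow the coupling constants to vary over
the edges, but assume that `J_{u,v} > 0` for all `{u,v} ∈ ℰ`", the graph being "any finite graph
(not necessarily planar)". We write `κ_e := βJ_e > 0` for the edge stiffness; the edge factor is
then the tree's periodised Gaussian
`Literature.MathematicalPhysics.QuantumFieldTheory.villainKernel κ_e (θ_{t e} − θ_{s e})`
(`= ∑_{n ∈ ℤ} exp(−(κ_e/2)(θ + 2πn)²)`, even and `2π`-periodic, so the orientation of an edge is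
immaterial). Edges are indexed by a finite type `ι` with end-point maps `s t : ι → V`; AS PRINTED
the fact is stated for a finite SIMPLE graph — no loops (`s e ≠ t e`) and at most one edge per
unordered pair (`e ↦ {s e, t e}` injective into `Sym2 V`) — which are hypotheses of the named fact.
(Multigraphs are NOT part of the vendored statement. A user who needs parallel edges or loops —
e.g. the discrete 4-torus of the BEC route with a side of length `≤ 2` — derives that case as a
THEOREM from the fact: `villainKernel κ` is the heat kernel on the circle at time `1/κ`, so
subdividing an edge of stiffness `κ` into two edges of stiffness `2κ` in series leaves the joint law
of the original spins unchanged (Chapman–Kolmogorov), which makes any multigraph simple, and a loop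
contributes the constant factor `villainKernel κ 0`, cancelling in the ratio.)

## The fact (as printed)

§11.3, Corollary 11.4: "Another implication of interest, which is obtained by combining
Theorem 11.2 [the metric-graph Villain model is the `N → ∞` limit of the `XY` models obtained by
splitting every edge into `N` edges with `N`-fold couplings] with the known `XY` Ginibre
inequality [Gin70] is: **Cor 11.4.** The spin-spin two-point function of the Villain model is
pointwise monotone in the coupling constants along each edge, and hence in the volume of the
system. Consequently, the infinite-volume limit of the two-point function exists."
("Monotone" = non-decreasing, the direction of Ginibre's inequality `∂⟨cos⟩/∂J ≥ 0`; §3.1: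
"`⟨σ_x · σ_y⟩_{β,L}` is monotone increasing in `L`, and more generally in the volume".)
We vendor the first sentence, for finitely many edges at once (equivalent to edge-by-edge).

Discharging it (`…_holds`) = the source's proof: Ginibre for the refined `XY` model is the tree's
`Literature.Probability.LatticeModels.ginibreExpect_reChar_mono` (torus `U(1)^{𝒱_N}`), plus the
local CLT of Thm 11.2 (`(I_J(Nκ)/I₀(Nκ))^N → e^{−J²/(2κ)}`) and passage to the limit in `≤`.

## Use

Grounds `Summit.AtomisticToContinuum.BoseEinsteinCondensation.Theses.BECStoquasticCensoring.VillainCurrentLRO`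
(stmt-AtomisticToContinuum-11474): by Fourier duality on each edge (Poisson summation,
`villainKernel κ φ = (2πκ)^{-1/2} ∑_{J ∈ ℤ} e^{−J²/(2κ)} e^{iJφ}`) the worm ratio
`Z_κ(δ_x − δ_y)/Z_κ(0)` of the zero-divergence integer-current model with weights
`∏ exp(−J_e²/(2κ_e))` used in that route equals `villainTwoPoint s t κ x y` on the same
graph — there the 4-torus `(ℤ/(M+1))³ × ℤ/(T+1)` with its `4` lattice directions (simple as
soon as `M + 1 ≥ 3` and `T + 1 ≥ 3`; smaller sides via the subdivision remark above) — so the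
inhomogeneous statement (`K_i ≤ κ_{x,i} ≤ ΛK_i`) follows from the homogeneous one
(`HomogeneousVillainLRO`, stmt-11478, `κ_{x,i} = K_i`) and this fact; the upper bound `ΛK_i` is
not even needed. The duality identity and the subdivision step are theorems to be proved by the
user, not part of the fact.

## References

* [AizenmanHarelPeledShapiro2021] M. Aizenman, M. Harel, R. Peled, J. Shapiro, arXiv:2110.09498,
  §3.1 (the models), §11 (edge-dependent couplings), Thm 11.2, Cor. 11.4.
* [Ginibre1970] J. Ginibre, Comm. Math. Phys. 16 (1970) 310–328 (Prop. 3; Model 3, plane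
  rotators).
* Fröhlich–Spencer, Comm. Math. Phys. 81 (1981) 527–602, §1.4 (thermodynamic limit of the
  Villain model "a consequence of correlation inequalities [Ginibre]").
-/

noncomputable section

open MeasureTheory

namespace Literature.Probability.LatticeModels

variable {V ι : Type*} [Fintype V] [Fintype ι]

/-- The Villain Gibbs weight of an angle configuration `θ : V → ℝ` on a finite multigraph with
edges `e : ι` from `s e` to `t e` carrying stiffness `κ e = βJ_e`:
`∏_e ∑_{n ∈ ℤ} exp(−(κ_e/2)(θ_{t e} − θ_{s e} + 2πn)²)`.
[cite: AizenmanHarelPeledShapiro2021, §3.1 (Villain substitution) and §11] -/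
def villainSpinWeight (s t : ι → V) (κ : ι → ℝ) (θ : V → ℝ) : ℝ :=
  ∏ e, Literature.MathematicalPhysics.QuantumFieldTheory.villainKernel (κ e) (θ (t e) - θ (s e))

/-- The angle cube `[-π, π)^V`, the configuration space integrated over with Lebesgue measure.
[cite: AizenmanHarelPeledShapiro2021, §3.1 (Z_XY)] -/
def angleCube (V : Type*) : Set (V → ℝ) :=
  Set.pi Set.univ fun _ => Set.Ico (-Real.pi) Real.pi

/-- The spin–spin two-point function `⟨σ_x · σ_y⟩ = ⟨cos(θ_x − θ_y)⟩` of the finite-volume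
Villain Gibbs state (free boundary conditions = whatever the graph is):
`(∫ cos(θ_x − θ_y) w_κ(θ) dθ) / (∫ w_κ(θ) dθ)` over `[-π, π)^V`.
[cite: AizenmanHarelPeledShapiro2021, §3.1 ("σ_x · σ_y = cos(θ_x − θ_y)", normalised Gibbs state)] -/
def villainTwoPoint (s t : ι → V) (κ : ι → ℝ) (x y : V) : ℝ :=
  (∫ θ in angleCube V, Real.cos (θ x - θ y) * villainSpinWeight s t κ θ) /
    ∫ θ in angleCube V, villainSpinWeight s t κ θ

/-- NAMED FACT — **Aizenman–Harel–Peled–Shapiro 2021, Corollary 11.4 (Ginibre monotonicity for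
the Villain model).** "The spin-spin two-point function of the Villain model is pointwise monotone
in the coupling constants along each edge, and hence in the volume of the system": on any finite
simple graph (no loops, at most one edge per pair of vertices — the source's "any finite graph",
§11 first paragraph, edges `{u,v} ∈ ℰ` with `J_{u,v} > 0`), if `0 < κ_e ≤ κ'_e` for every edge then
`⟨cos(θ_x − θ_y)⟩_κ ≤ ⟨cos(θ_x − θ_y)⟩_{κ'}` for all vertices `x, y`. Obtained in the source from
the `XY` Ginibre inequality (in tree:
`ginibreExpect_reChar_mono`) and the metric-graph limit Thm 11.2; not proved here. Users take
`(h : AizenmanHarelPeledShapiro2021_villainTwoPoint_mono)`.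
[cite: AizenmanHarelPeledShapiro2021, Cor. 11.4 (with Thm 11.2 and §11, first paragraph)]
Grounds `Summit.AtomisticToContinuum.BoseEinsteinCondensation.Theses.BECStoquasticCensoring.VillainCurrentLRO`
(reduction to `HomogeneousVillainLRO` after current–angle duality). -/
def AizenmanHarelPeledShapiro2021_villainTwoPoint_mono : Prop :=
  ∀ (V ι : Type) [Fintype V] [Fintype ι] (s t : ι → V),
    (∀ e, s e ≠ t e) → Function.Injective (fun e => Sym2.mk (s e, t e)) →
    ∀ κ κ' : ι → ℝ, (∀ e, 0 < κ e) → (∀ e, κ e ≤ κ' e) →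
      ∀ x y : V, villainTwoPoint s t κ x y ≤ villainTwoPoint s t κ' x y

end Literature.Probability.LatticeModels

end
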